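import Literature.NumberTheory.PAdicHodge.BdRPlusEmbedding
import Mathlib.FieldTheory.Perfect
import Mathlib.FieldTheory.IntermediateField.Adjoin.Basic
import HarnessLib

/-!
# The algebraic closure inside `B_dR⁺`: the `Γ_F`-equivariant section `F̄ ↪ B_dR⁺(F)` of `θ`

Let `F` be a `p`-adic local field, `F̄ = AlgebraicClosure F`, `ℂ_F` the completion of `F̄`
(`algClosureToC : F̄ → ℂ_F`), and `B_dR⁺ = B_dR⁺(F)` with `θ : B_dR⁺ ↠ ℂ_F` (`thetaBdR`) and the
embedding `F ↪ B_dR⁺` (`embBdRHom`, `BdRPlusEmbedding`). Since `B_dR⁺` is a complete local ring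
with residue field `ℂ_F ⊇ F̄` and `F̄/F` is separable, Hensel's lemma lifts every `x ∈ F̄`
uniquely to a root in `B_dR⁺` of its minimal polynomial over `F` reducing to `x`:

* `exists_aeval_eq_zero_of_thetaBdR` / `eq_of_aeval_eq_zero`: simple roots of `F`-polynomials in
  `ℂ_F` lift uniquely to `B_dR⁺`;
* `algHomOfFinite`: every finite subextension `L ⊆ F̄` of `F` has an `F`-embedding `L → B_dR⁺`
  lifting `L ⊆ ℂ_F` (power basis + Hensel), and such embeddings are pinned down elementwise
  (`algHom_apply_eq_liftElt`);
* **`algClosureToBdR hp hF : F̄ →+* B_dR⁺(F)`**, the unique ring homomorphism with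
  `θ ∘ algClosureToBdR = algClosureToC` (`thetaBdR_algClosureToBdR`) extending `F ↪ B_dR⁺`
  (`algClosureToBdR_algebraMap`); it is injective and **`Γ_F`-equivariant**
  (`galBdRPlus_algClosureToBdR`: `σ(ι x) = ι(σ x)`).

This is Fontaine 1994, Exp. II, 1.5.3 / Fontaine–Ouyang Prop. 5.1.7 ("`P̄ ⊆ B_dR⁺`"); it is the
algebraic half of the embedding `F̂_nr ⊆ B_dR⁺` needed for the de Rham-ness of unramified
representations.

## References
* [FontaineAsterisque223III] J.-M. Fontaine, Astérisque 223 (1994), Exp. II §1.5.3.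
* [FontaineOuyang2022] J.-M. Fontaine, Y. Ouyang, *Theory of p-adic Galois representations*, Prop. 5.1.7.
-/

noncomputable section

open ValuativeRel Field Ideal WittVector UniformSpace Polynomial
open Literature.AlgebraicGeometry.Resolution

namespace Literature.NumberTheory.PAdicHodge

open Literature.NumberTheory.GaloisRepresentations
open Literature.NumberTheory.GaloisRepresentations.IsNonarchimedeanLocalField

variable {F : Type} [Field F] [ValuativeRel F] [TopologicalSpace F] [IsNonarchimedeanLocalField F]
  [CharZero F] {p : ℕ} [Fact p.Prime] [Fact (¬ IsUnit (p : integerC F))]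
  [IsAdicComplete (Ideal.span {(p : integerC F)}) (integerC F)]
  (hp : valuation F p < 1) (hF : Function.Surjective (fontaineTheta (integerC F) p))

/-! ### `F`-algebra structures and the maps `θ`, `F̄ → ℂ_F` as `F`-algebra homomorphisms -/

/-- `B_dR⁺(F)` as an `F`-algebra through `embBdRHom` (to be installed with `letI`). [folklore] -/
abbrev bdRPlusAlgebraF : Algebra F (BDeRhamPlus (integerC F) p) := (embBdRHom hp hF).toAlgebra

/-- Unfolding of the `F`-algebra structure on `B_dR⁺`. [folklore] -/
theorem algebraMap_bdRPlusAlgebraF (a : F) :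
    (letI := bdRPlusAlgebraF hp hF; algebraMap F (BDeRhamPlus (integerC F) p) a) = embBdRHom hp hF a := rfl

/-- `θ : B_dR⁺ → ℂ_F` as an `F`-algebra homomorphism. [folklore] -/
def thetaAlgHom : letI := bdRPlusAlgebraF hp hF; BDeRhamPlus (integerC F) p →ₐ[F] CompletedAlgClosure F :=
  letI := bdRPlusAlgebraF hp hF
  { thetaBdR (F := F) (p := p) with
    commutes' := fun a => thetaBdR_embBdRHom hp hF a }

/-- Unfolding of `thetaAlgHom`. [folklore] -/
theorem thetaAlgHom_apply (b : BDeRhamPlus (integerC F) p) :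
    (letI := bdRPlusAlgebraF hp hF; thetaAlgHom hp hF b) = thetaBdR b := rfl

omit [CharZero F] [Fact p.Prime] [Fact (¬ IsUnit (p : integerC F))]
  [IsAdicComplete (Ideal.span {(p : integerC F)}) (integerC F)] in
variable (F) in
/-- `F̄ → ℂ_F` as an `F`-algebra homomorphism. [folklore] -/
def algClosureToCAlgHom : AlgebraicClosure F →ₐ[F] CompletedAlgClosure F :=
  { algClosureToC F with commutes' := fun a => algClosureToC_algebraMap a }

omit [CharZero F] [Fact p.Prime] [Fact (¬ IsUnit (p : integerC F))]
  [IsAdicComplete (Ideal.span {(p : integerC F)}) (integerC F)] in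
/-- Unfolding of `algClosureToCAlgHom`. [folklore] -/
theorem algClosureToCAlgHom_apply (x : AlgebraicClosure F) : algClosureToCAlgHom F x = algClosureToC F x := rfl

/-- `θ(q(b)) = q(θ b)` for `q ∈ F[X]`. [folklore] -/
theorem thetaBdR_aeval (q : F[X]) (b : BDeRhamPlus (integerC F) p) :
    thetaBdR (letI := bdRPlusAlgebraF hp hF; aeval b q) = aeval (thetaBdR b) q := by
  letI := bdRPlusAlgebraF hp hF
  exact (aeval_algHom_apply (thetaAlgHom hp hF) b q).symm

/-- `σ(q(b)) = q(σ b)` for `q ∈ F[X]` (`Γ_F` fixes `F ⊆ B_dR⁺`). [folklore] -/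
theorem galBdRPlus_aeval (σ : absoluteGaloisGroup F) (q : F[X]) (b : BDeRhamPlus (integerC F) p) :
    galBdRPlus σ (letI := bdRPlusAlgebraF hp hF; aeval b q) = (letI := bdRPlusAlgebraF hp hF; aeval (galBdRPlus σ b) q) := by
  letI := bdRPlusAlgebraF hp hF
  let g : BDeRhamPlus (integerC F) p →ₐ[F] BDeRhamPlus (integerC F) p :=
    { galBdRPlus σ with commutes' := fun a => galBdRPlus_embBdRHom hp hF σ a }
  exact (aeval_algHom_apply g b q).symm

/-! ### Hensel: simple roots lift uniquely from `ℂ_F` to `B_dR⁺` -/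

/-- **Uniqueness**: two roots in `B_dR⁺` of `q ∈ F[X]` with the same image under `θ`, a simple
root of `q` in `ℂ_F`, coincide. [cite: FontaineOuyang2022, Prop. 5.1.7] -/
theorem eq_of_aeval_eq_zero (q : F[X]) {b b' : BDeRhamPlus (integerC F) p}
    (hb : (letI := bdRPlusAlgebraF hp hF; aeval b q) = 0) (hb' : (letI := bdRPlusAlgebraF hp hF; aeval b' q) = 0)
    (hθ : thetaBdR b' = thetaBdR b) (hder : aeval (thetaBdR b) (derivative q) ≠ 0) : b' = b := by
  letI := bdRPlusAlgebraF hp hF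
  refine root_unique hF (q.map (algebraMap F (BDeRhamPlus (integerC F) p))) ?_ ?_ hθ ?_
  · rwa [Polynomial.eval_map_algebraMap]
  · rwa [Polynomial.eval_map_algebraMap]
  · rwa [derivative_map, Polynomial.eval_map_algebraMap, thetaBdR_aeval]

/-- **Existence (Hensel)**: a simple root `c ∈ ℂ_F` of a monic `q ∈ F[X]` lifts to a root of `q` in
`B_dR⁺` reducing to `c`. [cite: FontaineAsterisque223III, Exp. II §1.5.3] [cite: FontaineOuyang2022, Prop. 5.1.7] -/
theorem exists_aeval_eq_zero_of_thetaBdR {q : F[X]} (hq : q.Monic) {c : CompletedAlgClosure F}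
    (hc : aeval c q = 0) (hc' : aeval c (derivative q) ≠ 0) :
    ∃ b : BDeRhamPlus (integerC F) p, thetaBdR b = c ∧ (letI := bdRPlusAlgebraF hp hF; aeval b q) = 0 := by
  letI := bdRPlusAlgebraF hp hF
  set I : Ideal (BDeRhamPlus (integerC F) p) := (RingHom.ker (fontaineThetaInvertP (integerC F) p)).map
      (algebraMap (Localization.Away (p : Ainf (p := p) F)) (BDeRhamPlus (integerC F) p)) with hI
  haveI : IsAdicComplete I (BDeRhamPlus (integerC F) p) := isAdicComplete_bDeRhamPlus
  have hIspan : I = Ideal.span {(xiBdR : BDeRhamPlus (integerC F) p)} := map_ker_eq_span_xiBdR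
  obtain ⟨a₀, ha₀⟩ := thetaBdR_surjective hF c
  have hgm : (q.map (algebraMap F (BDeRhamPlus (integerC F) p))).Monic := hq.map _
  have h1 : (q.map (algebraMap F (BDeRhamPlus (integerC F) p))).eval a₀ ∈ I := by
    rw [hIspan, ← mem_ker_thetaBdR_iff, Polynomial.eval_map_algebraMap, thetaBdR_aeval, ha₀, hc]
  have h2 : IsUnit (Ideal.Quotient.mk I ((q.map (algebraMap F (BDeRhamPlus (integerC F) p))).derivative.eval a₀)) := by
    refine ((isUnit_iff_thetaBdR_ne_zero hF _).2 ?_).map _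
    rwa [derivative_map, Polynomial.eval_map_algebraMap, thetaBdR_aeval, ha₀]
  obtain ⟨a, ha, haa₀⟩ := HenselianRing.is_henselian _ hgm a₀ h1 h2
  refine ⟨a, ?_, by rwa [IsRoot.def, Polynomial.eval_map_algebraMap] at ha⟩
  rw [hIspan, ← mem_ker_thetaBdR_iff, map_sub, sub_eq_zero] at haa₀
  rw [haa₀, ha₀]

/-! ### The lift of an algebraic element -/

omit [ValuativeRel F] [TopologicalSpace F] [IsNonarchimedeanLocalField F] [Fact p.Prime]
  [Fact (¬ IsUnit (p : integerC F))] [IsAdicComplete (Ideal.span {(p : integerC F)}) (integerC F)] in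
/-- Elements of `F̄` are separable over `F` (characteristic `0`). [folklore] -/
theorem isSeparable_algClosure (x : AlgebraicClosure F) : IsSeparable F x :=
  Algebra.IsSeparable.isSeparable F x

/-- `x ∈ F̄ ⊆ ℂ_F` is a simple root of its minimal polynomial. [folklore] -/
theorem aeval_derivative_minpoly_ne_zero (x : AlgebraicClosure F) :
    aeval (algClosureToC F x) (derivative (minpoly F x)) ≠ 0 := by
  rw [← algClosureToCAlgHom_apply, aeval_algHom_apply, algClosureToCAlgHom_apply,
    map_ne_zero_iff _ (algClosureToC F).injective]
  exact (isSeparable_algClosure x).aeval_derivative_ne_zero (minpoly.aeval F x)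

omit [CharZero F] [Fact p.Prime] [Fact (¬ IsUnit (p : integerC F))]
  [IsAdicComplete (Ideal.span {(p : integerC F)}) (integerC F)] in
/-- `x ∈ F̄ ⊆ ℂ_F` is a root of its minimal polynomial. [folklore] -/
theorem aeval_algClosureToC_minpoly (x : AlgebraicClosure F) :
    aeval (algClosureToC F x) (minpoly F x) = 0 := by
  rw [← algClosureToCAlgHom_apply, aeval_algHom_apply, minpoly.aeval, map_zero]

/-- Existence of the lift of `x ∈ F̄`: a root of `minpoly F x` in `B_dR⁺` with `θ = x`. [cite: FontaineOuyang2022, Prop. 5.1.7] -/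
theorem exists_liftElt (x : AlgebraicClosure F) :
    ∃ b : BDeRhamPlus (integerC F) p, thetaBdR b = algClosureToC F x ∧
      (letI := bdRPlusAlgebraF hp hF; aeval b (minpoly F x)) = 0 :=
  exists_aeval_eq_zero_of_thetaBdR hp hF (minpoly.monic (Algebra.IsIntegral.isIntegral x))
    (aeval_algClosureToC_minpoly x) (aeval_derivative_minpoly_ne_zero x)

/-- **The lift `x̃ ∈ B_dR⁺` of `x ∈ F̄`**: the unique root of `minpoly F x` with `θ(x̃) = x`. [cite: FontaineOuyang2022, Prop. 5.1.7] -/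
def liftElt (x : AlgebraicClosure F) : BDeRhamPlus (integerC F) p := (exists_liftElt hp hF x).choose

/-- `θ(x̃) = x`. [folklore] -/
theorem thetaBdR_liftElt (x : AlgebraicClosure F) : thetaBdR (liftElt hp hF x) = algClosureToC F x :=
  (exists_liftElt hp hF x).choose_spec.1

/-- `x̃` is a root of `minpoly F x`. [folklore] -/
theorem aeval_liftElt (x : AlgebraicClosure F) :
    (letI := bdRPlusAlgebraF hp hF; aeval (liftElt hp hF x) (minpoly F x)) = 0 :=
  (exists_liftElt hp hF x).choose_spec.2

/-- **Characterisation of `x̃`**: any root `b` of `minpoly F x` in `B_dR⁺` with `θ b = x` is `x̃`. [folklore] -/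
theorem eq_liftElt {x : AlgebraicClosure F} {b : BDeRhamPlus (integerC F) p}
    (hb : (letI := bdRPlusAlgebraF hp hF; aeval b (minpoly F x)) = 0) (hθ : thetaBdR b = algClosureToC F x) :
    b = liftElt hp hF x := by
  refine eq_of_aeval_eq_zero hp hF (minpoly F x) (aeval_liftElt hp hF x) hb ?_ ?_
  · rw [hθ, thetaBdR_liftElt]
  · rw [thetaBdR_liftElt]; exact aeval_derivative_minpoly_ne_zero x

/-! ### Finite subextensions embed, and their embeddings are computed by `liftElt` -/

/-- **An `F`-embedding `L → B_dR⁺` lifting `L ⊆ ℂ_F` sends every `x ∈ L` to `x̃`.** [folklore] -/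
theorem algHom_apply_eq_liftElt {L : IntermediateField F (AlgebraicClosure F)}
    (φ : letI := bdRPlusAlgebraF hp hF; L →ₐ[F] BDeRhamPlus (integerC F) p)
    (hφ : ∀ y : L, thetaBdR (φ y) = algClosureToC F y) (x : L) :
    φ x = liftElt hp hF (x : AlgebraicClosure F) := by
  letI := bdRPlusAlgebraF hp hF
  refine eq_liftElt hp hF ?_ (hφ x)
  have hmin : minpoly F (x : AlgebraicClosure F) = minpoly F x := by
    rw [← minpoly.algHom_eq L.val Subtype.val_injective x]; rfl
  change aeval (φ x) (minpoly F (x : AlgebraicClosure F)) = 0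
  rw [hmin, aeval_algHom_apply, minpoly.aeval, map_zero]

/-- **Every finite subextension `L/F` of `F̄` embeds into `B_dR⁺` over `F` compatibly with `θ`**
(power basis of `L/F` — separable — and the Hensel lift of its generator). [cite: FontaineOuyang2022, Prop. 5.1.7] -/
theorem exists_algHom_of_finiteDimensional (L : IntermediateField F (AlgebraicClosure F)) [FiniteDimensional F L] :
    ∃ φ : (letI := bdRPlusAlgebraF hp hF; L →ₐ[F] BDeRhamPlus (integerC F) p),
      ∀ y : L, thetaBdR (φ y) = algClosureToC F y := by
  letI := bdRPlusAlgebraF hp hF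
  let pb := Field.powerBasisOfFiniteOfSeparable F L
  have hmin : minpoly F pb.gen = minpoly F (pb.gen : AlgebraicClosure F) :=
    (minpoly.algHom_eq L.val Subtype.val_injective pb.gen).symm
  have hroot : aeval (liftElt hp hF (pb.gen : AlgebraicClosure F)) (minpoly F pb.gen) = 0 := by
    rw [hmin]; exact aeval_liftElt hp hF _
  refine ⟨pb.lift (liftElt hp hF (pb.gen : AlgebraicClosure F)) hroot, ?_⟩
  -- both `θ ∘ φ` and `L ⊆ F̄ → ℂ_F` are `F`-algebra maps agreeing on the generator
  have key : (thetaAlgHom hp hF).comp (pb.lift (liftElt hp hF (pb.gen : AlgebraicClosure F)) hroot) =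
      (algClosureToCAlgHom F).comp L.val := by
    refine pb.algHom_ext ?_
    rw [AlgHom.comp_apply, pb.lift_gen, AlgHom.comp_apply, thetaAlgHom_apply, thetaBdR_liftElt]
    rfl
  intro y
  have h := congrArg (fun ψ => ψ y) key
  simp only [AlgHom.comp_apply, thetaAlgHom_apply, algClosureToCAlgHom_apply] at h
  exact h

/-! ### The embedding `F̄ ↪ B_dR⁺` -/

/-- `liftElt` is additive and multiplicative: computed inside the finite extension `F(x, y)`. [folklore] -/
theorem liftElt_add_mul (x y : AlgebraicClosure F) :
    liftElt hp hF (x + y) = liftElt hp hF x + liftElt hp hF y ∧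
      liftElt hp hF (x * y) = liftElt hp hF x * liftElt hp hF y := by
  letI := bdRPlusAlgebraF hp hF
  let L : IntermediateField F (AlgebraicClosure F) := IntermediateField.adjoin F {x, y}
  haveI : FiniteDimensional F L := IntermediateField.finiteDimensional_adjoin
    (fun z _ => Algebra.IsIntegral.isIntegral z)
  have hx : x ∈ L := IntermediateField.subset_adjoin F _ (Set.mem_insert x {y})
  have hy : y ∈ L := IntermediateField.subset_adjoin F _ (Set.mem_insert_of_mem x rfl)
  obtain ⟨φ, hφ⟩ := exists_algHom_of_finiteDimensional hp hF L
  have ex := algHom_apply_eq_liftElt hp hF φ hφ ⟨x, hx⟩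
  have ey := algHom_apply_eq_liftElt hp hF φ hφ ⟨y, hy⟩
  have exy := algHom_apply_eq_liftElt hp hF φ hφ (⟨x, hx⟩ + ⟨y, hy⟩)
  have exy' := algHom_apply_eq_liftElt hp hF φ hφ (⟨x, hx⟩ * ⟨y, hy⟩)
  rw [map_add, ex, ey] at exy
  rw [map_mul, ex, ey] at exy'
  exact ⟨exy.symm, exy'.symm⟩

/-- `liftElt` on `F`: `ã = a` (the embedding `F ↪ B_dR⁺`). [folklore] -/
theorem liftElt_algebraMap (a : F) :
    liftElt hp hF (algebraMap F (AlgebraicClosure F) a) = embBdRHom hp hF a := by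
  letI := bdRPlusAlgebraF hp hF
  haveI : FiniteDimensional F (⊥ : IntermediateField F (AlgebraicClosure F)) :=
    Module.finite_of_finrank_eq_succ IntermediateField.finrank_bot
  obtain ⟨φ, hφ⟩ := exists_algHom_of_finiteDimensional hp hF (⊥ : IntermediateField F (AlgebraicClosure F))
  have h := algHom_apply_eq_liftElt hp hF φ hφ (algebraMap F _ a)
  rw [AlgHom.commutes] at h
  rw [IntermediateField.coe_algebraMap_apply] at h
  exact h.symm

/-- **`ι : F̄ ↪ B_dR⁺(F)`**, the section of `θ` over the algebraic closure of `F`: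
`x ↦ x̃`, the unique root of `minpoly F x` with `θ(x̃) = x`. A ring homomorphism.
[cite: FontaineAsterisque223III, Exp. II §1.5.3] [cite: FontaineOuyang2022, Prop. 5.1.7] -/
def algClosureToBdR : AlgebraicClosure F →+* BDeRhamPlus (integerC F) p where
  toFun := liftElt hp hF
  map_one' := by rw [← (algebraMap F (AlgebraicClosure F)).map_one, liftElt_algebraMap, map_one]
  map_mul' x y := (liftElt_add_mul hp hF x y).2
  map_zero' := by rw [← (algebraMap F (AlgebraicClosure F)).map_zero, liftElt_algebraMap, map_zero]
  map_add' x y := (liftElt_add_mul hp hF x y).1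

/-- Unfolding of `algClosureToBdR`. [folklore] -/
theorem algClosureToBdR_apply (x : AlgebraicClosure F) : algClosureToBdR hp hF x = liftElt hp hF x := rfl

/-- **`θ ∘ ι = (F̄ ⊆ ℂ_F)`.** [cite: FontaineAsterisque223III, Exp. II §1.5.3] -/
theorem thetaBdR_algClosureToBdR (x : AlgebraicClosure F) :
    thetaBdR (algClosureToBdR hp hF x) = algClosureToC F x :=
  thetaBdR_liftElt hp hF x

/-- **`ι` extends `F ↪ B_dR⁺`.** [cite: FontaineAsterisque223III, Exp. II §1.5.3] -/
theorem algClosureToBdR_algebraMap (a : F) :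
    algClosureToBdR hp hF (algebraMap F (AlgebraicClosure F) a) = embBdRHom hp hF a :=
  liftElt_algebraMap hp hF a

/-- `ι` is injective. [folklore] -/
theorem algClosureToBdR_injective : Function.Injective (algClosureToBdR hp hF) := by
  haveI := isLocalRing_bDeRhamPlus (F := F) (p := p) hF
  exact (algClosureToBdR hp hF).injective

/-- **`ι` is `Γ_F`-equivariant: `σ(ι x) = ι(σ x)`** (both are roots of `minpoly F x = minpoly F (σ x)`
reducing to `σ x`). [cite: FontaineAsterisque223III, Exp. II §1.5.3] -/
theorem galBdRPlus_algClosureToBdR (σ : absoluteGaloisGroup F) (x : AlgebraicClosure F) :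
    galBdRPlus σ (algClosureToBdR hp hF x) = algClosureToBdR hp hF (σ • x) := by
  letI := bdRPlusAlgebraF hp hF
  rw [algClosureToBdR_apply, algClosureToBdR_apply]
  refine eq_liftElt hp hF ?_ ?_
  · have hmin : minpoly F (σ • x) = minpoly F x := minpoly.algEquiv_eq σ x
    rw [hmin, ← galBdRPlus_aeval hp hF, aeval_liftElt, map_zero]
  · rw [thetaBdR_galBdRPlus, thetaBdR_liftElt, smul_algClosureToC]

/-- `σ • ι x = ι (σ • x)`. [cite: FontaineAsterisque223III, Exp. II §1.5.3] -/
theorem smul_algClosureToBdR (σ : absoluteGaloisGroup F) (x : AlgebraicClosure F) :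
    σ • algClosureToBdR hp hF x = algClosureToBdR hp hF (σ • x) :=
  galBdRPlus_algClosureToBdR hp hF σ x

/-- **`𝒪_{F_nr} → B_dR⁺(F)`**: the restriction of `ι` to the unramified integers, with
`θ ∘ ι = (𝒪_{F_nr} ⊆ 𝒪_{ℂ_F})`. [cite: FontaineAsterisque223III, Exp. II §1.5.3] -/
def maxUnramifiedIntegersToBdR : maxUnramifiedIntegers F →+* BDeRhamPlus (integerC F) p :=
  (algClosureToBdR hp hF).comp (maxUnramifiedIntegers F).val.toRingHom

/-- `θ ∘ (𝒪_{F_nr} → B_dR⁺) = (𝒪_{F_nr} → 𝒪_{ℂ_F})`. [folklore] -/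
theorem thetaBdR_maxUnramifiedIntegersToBdR (b : maxUnramifiedIntegers F) :
    thetaBdR (maxUnramifiedIntegersToBdR hp hF b) = ((ofMaxUnramifiedIntegers F b : integerC F) : CompletedAlgClosure F) := by
  rw [maxUnramifiedIntegersToBdR, RingHom.comp_apply, thetaBdR_algClosureToBdR, coe_ofMaxUnramifiedIntegers]
  rfl

end Literature.NumberTheory.PAdicHodge

end
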